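import Summits.NavierStokesRegularity.NavierStokesRegularity.Theses.AxisymmetricExtremality
import Summits.NavierStokesRegularity.NavierStokesRegularity.Theorems.AxisymmetricLiouvilleBoundedSwirl
import Literature.Analysis.FluidPDE.Axisymmetric
import Literature.Analysis.FluidPDE.KatoMaximalTime
import Literature.Analysis.FluidPDE.AxisymmetricTypeIBounded
import Literature.Barriers.NavierStokesRegularity.AxisymmetricTypeIExclusion
import HarnessLib

/-!
# Strategist s12-g4 (independent census, family `s`) — typed exhibits for `STRATEGY-CENSUS-s12.md`

Crux (fixed, never restated): `Theses.AxisymmetricExtremality.AxisymmetricKatoGlobal`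
(item stmt-NavierStokesRegularity-15453).  This file only TYPES the statements discussed in the
census (weaker intermediate, decompositions, strengthening, negation) and proves the elementary
logical relations between them; it registers nothing and contains no `sorry`.
-/

noncomputable section

open Set MeasureTheory Filter Topology Function Metric
open scoped ENNReal NNReal
open Literature.Analysis.FluidPDE Literature.Analysis.FunctionSpaces

namespace Summit.NavierStokesRegularity.NavierStokesRegularity.Cruxes.AxisymmetricKatoGlobal.StrategistS12g4

set_option linter.unusedVariables false
set_option linter.dupNamespace false

local notation "ℝ³" => EuclideanSpace ℝ (Fin 3)
local notation "ℂ³" => EuclideanSpace ℂ (Fin 3)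

open Theses.AxisymmetricExtremality

/-! ## §W  Weaker intermediate: the threshold instance that `closes` actually consumes -/

/-- **T** — no axisymmetric `Ḣ^{1/2}`-minimal blow-up datum (Rusin–Šverák's set `M` misses the
axisymmetric class). This is all that `closes` uses of the crux. -/
def ThresholdInstance : Prop :=
  ∀ ν : ℝ, 0 < ν → ∀ (u₀ : ℝ³ → ℝ³) (g : HomSobolev ℝ³ ℂ³ (1 / 2 : ℝ)),
    IsMinimalBlowupDatum ν u₀ g → IsAxisymmetric u₀ → False

/-- Clay (A) fails at viscosity `ν` (verbatim the antecedent of `MinimalDatumPFold`). -/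
def ClayFailsAt (ν : ℝ) : Prop :=
  ∃ v₀ : ℝ³ → ℝ³, ContDiff ℝ (⊤ : ℕ∞) v₀ ∧ NSWave0.IsDivFree v₀ ∧ HasRapidSpatialDecay v₀ ∧
    ¬ ∃ (u : ℝ → ℝ³ → ℝ³) (p : ℝ → ℝ³ → ℝ), IsSmoothOnHalfSpace u ∧ IsSmoothOnHalfSpace p ∧
      IsNavierStokesSolution ν 0 v₀ u p ∧ HasBoundedEnergy u

/-- **T′** — the threshold instance asked only where Clay fails (the weakest statement the route's
glue can consume in the crux's slot). -/
def ThresholdInstanceClay : Prop :=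
  ∀ ν : ℝ, 0 < ν → ClayFailsAt ν → ∀ (u₀ : ℝ³ → ℝ³) (g : HomSobolev ℝ³ ℂ³ (1 / 2 : ℝ)),
    IsMinimalBlowupDatum ν u₀ g → IsAxisymmetric u₀ → False

/-- crux ⇒ T (unfold `IsMinimalBlowupDatum`; the rotation clause of the crux is `IsAxisymmetric`
by `rfl`). -/
theorem thresholdInstance_of_crux (h : AxisymmetricKatoGlobal) : ThresholdInstance := by
  intro ν hν u₀ g hmin hax
  obtain ⟨hL3, hrep, hdiv, -, hnot⟩ := hmin
  exact hnot (h ν hν u₀ g hL3 hrep hdiv (fun θ x => hax θ x))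

/-- T ⇒ T′. -/
theorem thresholdInstanceClay_of_thresholdInstance (h : ThresholdInstance) :
    ThresholdInstanceClay :=
  fun ν hν _ u₀ g hmin hax => h ν hν u₀ g hmin hax

/-- The route's glue re-run with T′ in the crux's slot: `closes` needs only the threshold
instance. -/
theorem closes_of_thresholdInstanceClay (h₂ : MinimalDatumPFold) (h₄ : PFoldToAxisymmetric)
    (h₃ : ThresholdInstanceClay) : NavierStokesRegularity := by
  show Literature.NS.NavierStokesExistenceSmoothR3
  intro ν hν u₀ hsm hdiv hdec
  by_contra hno
  have hfail : ClayFailsAt ν := ⟨u₀, hsm, hdiv, hdec, hno⟩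
  obtain ⟨u₁, g, hmin, hax⟩ := h₄ ν hν (h₂ ν hν hfail)
  exact h₃ ν hν hfail u₁ g hmin (fun θ x => hax θ x)

/-- Conversely the summit gives T′ by vacuity, so T′ is ON PATH (summit-implied) and
`NavierStokesRegularity ↔ MinimalDatumPFold ∧ PFoldToAxisymmetric ∧ T′` modulo the proved item. -/
theorem thresholdInstanceClay_of_summit (h : NavierStokesRegularity) : ThresholdInstanceClay := by
  intro ν hν hfail
  obtain ⟨v₀, hsm, hdiv, hdec, hno⟩ := hfail
  have h' : Literature.NS.NavierStokesExistenceSmoothR3 := h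
  exact absurd (h' ν hν v₀ hsm hdiv hdec) hno

/-- What minimality hands the prover a priori (and nothing more): the norm identity
`‖g‖ = ρ_max^pure(ν)` and `¬ HasGlobalKatoSolution` — no rate, no Type-I bound, no `Γ₀ ∈ L^∞`,
no finite energy.  Recorded as the projection used in the census (§W "why no leverage"). -/
theorem minimalDatum_gives (ν : ℝ) (u₀ : ℝ³ → ℝ³) (g : HomSobolev ℝ³ ℂ³ (1 / 2 : ℝ))
    (h : IsMinimalBlowupDatum ν u₀ g) :
    ‖g‖ₑ = rusinSverakRhoMaxPure ν ∧ ¬ HasGlobalKatoSolution ν u₀ :=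
  ⟨h.2.2.2.1, h.2.2.2.2⟩


/-- **W″ — strict threshold gap for the axisymmetric class**: where the pure threshold is finite,
axisymmetric data stay global slightly BEYOND it (`ρ_ax(ν) > ρ_max^pure(ν)`).  Strictly between
the crux and T: crux ⇒ gap (take `ρ = ⊤`) ⇒ T (a minimal datum has norm exactly `ρ_max^pure`). -/
def AxisymThresholdGap : Prop :=
  ∀ ν : ℝ, 0 < ν → rusinSverakRhoMaxPure ν < ⊤ →
    ∃ ρ : ℝ≥0∞, rusinSverakRhoMaxPure ν < ρ ∧
      ∀ (u₀ : ℝ³ → ℝ³) (g : HomSobolev ℝ³ ℂ³ (1 / 2 : ℝ)), MemLp u₀ 3 volume →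
        g.Represents (Literature.Analysis.FunctionSpaces.EuclideanSpace.complexify ∘ u₀) →
        IsWeaklyDivFree u₀ → IsAxisymmetric u₀ → ‖g‖ₑ < ρ → HasGlobalKatoSolution ν u₀

/-- crux ⇒ gap. -/
theorem gap_of_crux (h : AxisymmetricKatoGlobal) : AxisymThresholdGap := by
  intro ν hν hfin
  exact ⟨⊤, hfin, fun u₀ g hL3 hrep hdiv hax _ => h ν hν u₀ g hL3 hrep hdiv (fun θ x => hax θ x)⟩

/-- gap ⇒ T. -/
theorem thresholdInstance_of_gap (h : AxisymThresholdGap) : ThresholdInstance := by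
  intro ν hν u₀ g hmin hax
  obtain ⟨hL3, hrep, hdiv, hnorm, hnot⟩ := hmin
  have hfin : rusinSverakRhoMaxPure ν < ⊤ := by rw [← hnorm]; exact enorm_lt_top
  obtain ⟨ρ, hρ, hglob⟩ := h ν hν hfin
  exact hnot (hglob u₀ g hL3 hrep hdiv hax (by rw [hnorm]; exact hρ))

/-! ## §D  Decompositions (typed; each has one piece that is the whole crux) -/

/-- Common frame of both registered lines: an axisymmetric Kato solution on `[0,T)`, smooth
inside, from a datum represented in `Ḣ^{1/2}`. -/
def KatoAxisymFrame (ν T : ℝ) (u₀ : ℝ³ → ℝ³) (g : HomSobolev ℝ³ ℂ³ (1 / 2 : ℝ))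
    (u : ℝ → ℝ³ → ℝ³) : Prop :=
  g.Represents (Literature.Analysis.FunctionSpaces.EuclideanSpace.complexify ∘ u₀) ∧
    IsKatoSolutionOn T ν u₀ u ∧ ContDiffOn ℝ (⊤ : ℕ∞) (uncurry u) (Ioo 0 T ×ˢ univ) ∧
    ∀ t ∈ Ioo 0 T, IsAxisymmetric (u t)

/-- Pointwise Type-I rate at the space–time point `(T, x₀)`. -/
def TypeIAt (u : ℝ → ℝ³ → ℝ³) (T : ℝ) (x₀ : ℝ³) : Prop :=
  ∃ C r₀ : ℝ, 0 < r₀ ∧ ∀ t ∈ Ioo (T - r₀ ^ 2) T, ∀ x ∈ ball x₀ r₀,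
    ‖u t x‖ ≤ C / Real.sqrt (T - t)

/-- **D-A, piece 1 (KNOWN: Seregin–Šverák 2009 Thm 1.1 = barrier
`Literature.Barriers.NavierStokesRegularity.AxisymmetricTypeIExclusion`, proved in tree as
`…AxisymmetricTypeIExclusionHolds`; Leray–Hopf form `knss_no_axisymmetric_typeI_holds`):**
a Type-I axis point of an axisymmetric Kato solution is bounded near the top. -/
def PieceAxisTypeIRegular : Prop :=
  ∀ ν : ℝ, 0 < ν → ∀ T : ℝ, 0 < T → ∀ (u₀ : ℝ³ → ℝ³) (g : HomSobolev ℝ³ ℂ³ (1 / 2 : ℝ))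
    (u : ℝ → ℝ³ → ℝ³), KatoAxisymFrame ν T u₀ g u →
    ∀ x₀ : ℝ³, cylRadius x₀ = 0 → TypeIAt u T x₀ → IsBoundedNearTop u T x₀

/-- **D-A, piece 2 (OPEN ≡ the crux given piece 1 and the landed stubs 1, K, 2b′):** every axis
point of an axisymmetric Kato solution that is NOT bounded near the top is Type I. -/
def PieceAxisSingularIsTypeI : Prop :=
  ∀ ν : ℝ, 0 < ν → ∀ T : ℝ, 0 < T → ∀ (u₀ : ℝ³ → ℝ³) (g : HomSobolev ℝ³ ℂ³ (1 / 2 : ℝ))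
    (u : ℝ → ℝ³ → ℝ³), KatoAxisymFrame ν T u₀ g u →
    ∀ x₀ : ℝ³, cylRadius x₀ = 0 → ¬ IsBoundedNearTop u T x₀ → TypeIAt u T x₀

/-- The target both lines reduce the crux to (with the landed off-axis stub 2b′ and stub 1):
every AXIS point is bounded near the top. -/
def AxisPointsBounded : Prop :=
  ∀ ν : ℝ, 0 < ν → ∀ T : ℝ, 0 < T → ∀ (u₀ : ℝ³ → ℝ³) (g : HomSobolev ℝ³ ℂ³ (1 / 2 : ℝ))
    (u : ℝ → ℝ³ → ℝ³), KatoAxisymFrame ν T u₀ g u →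
    ∀ x₀ : ℝ³, cylRadius x₀ = 0 → IsBoundedNearTop u T x₀

/-- D-A glue (pure logic): the two pieces give boundedness of every axis point. -/
theorem axisPointsBounded_of_typeI_split (h₁ : PieceAxisTypeIRegular)
    (h₂ : PieceAxisSingularIsTypeI) : AxisPointsBounded := by
  intro ν hν T hT u₀ g u hfr x₀ hx₀
  by_contra hnb
  exact hnb (h₁ ν hν T hT u₀ g u hfr x₀ hx₀ (h₂ ν hν T hT u₀ g u hfr x₀ hx₀ hnb))

/-- … and conversely piece 2 is implied by the target outright (so piece 2 ≡ target given the
known piece 1: the split isolates nothing). -/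
theorem pieceAxisSingularIsTypeI_of_axisPointsBounded (h : AxisPointsBounded) :
    PieceAxisSingularIsTypeI :=
  fun ν hν T hT u₀ g u hfr x₀ hx₀ hnb => absurd (h ν hν T hT u₀ g u hfr x₀ hx₀) hnb

/-- **D-B (swirl-size split), piece 1 — small swirl, ABSOLUTE constant (OPEN; = the Kato-class
form of crux `SwirlThreshold.SmallSwirlRegularity`, stmt-NavierStokesRegularity-2002; print has
only RELATIVE smallness: Lei–Zhang 2017 Thm 1.4, Liu–Zhang arXiv:1702.06279).** -/
def PieceSmallSwirl (ε : ℝ) : Prop :=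
  ∀ ν : ℝ, 0 < ν → ∀ T : ℝ, 0 < T → ∀ (u₀ : ℝ³ → ℝ³) (g : HomSobolev ℝ³ ℂ³ (1 / 2 : ℝ))
    (u : ℝ → ℝ³ → ℝ³), KatoAxisymFrame ν T u₀ g u →
    (∀ t ∈ Ioo 0 T, ∀ x, |swirl (u t) x| ≤ ε * ν) →
    ∀ x₀ : ℝ³, cylRadius x₀ = 0 → IsBoundedNearTop u T x₀

/-- **D-B, piece 2 — large swirl (OPEN ≡ the crux: no tool distinguishes it from the whole).** -/
def PieceLargeSwirl (ε : ℝ) : Prop :=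
  ∀ ν : ℝ, 0 < ν → ∀ T : ℝ, 0 < T → ∀ (u₀ : ℝ³ → ℝ³) (g : HomSobolev ℝ³ ℂ³ (1 / 2 : ℝ))
    (u : ℝ → ℝ³ → ℝ³), KatoAxisymFrame ν T u₀ g u →
    (∃ t ∈ Ioo 0 T, ∃ x, ε * ν < |swirl (u t) x|) →
    ∀ x₀ : ℝ³, cylRadius x₀ = 0 → IsBoundedNearTop u T x₀

/-- D-B glue (excluded middle on `sup |Γ| ≤ ε ν`). -/
theorem axisPointsBounded_of_swirl_split (ε : ℝ) (h₁ : PieceSmallSwirl ε)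
    (h₂ : PieceLargeSwirl ε) : AxisPointsBounded := by
  intro ν hν T hT u₀ g u hfr x₀ hx₀
  by_cases hsm : ∀ t ∈ Ioo 0 T, ∀ x, |swirl (u t) x| ≤ ε * ν
  · exact h₁ ν hν T hT u₀ g u hfr hsm x₀ hx₀
  · push Not at hsm
    obtain ⟨t, ht, x, hx⟩ := hsm
    exact h₂ ν hν T hT u₀ g u hfr ⟨t, ht, x, hx⟩ x₀ hx₀

/-! ## §S  Strengthening: the bounded-swirl Liouville conjecture (S⁺) -/

/-- **S⁺** = the tree's conjecture leaf (KNSS 2009 §5, open; Zhang–Pan 2022 p. 12). -/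
def StrengthenLiouville : Prop := AxisymmetricLiouvilleBoundedSwirl

/-- What S⁺ would have to be combined with to reach the crux: a blow-up procedure at an axis
singular point of an axisymmetric Kato solution producing a NON-CONSTANT bounded ancient mild
axisymmetric solution with bounded swirl.  Print has it only under the Type-I (scaled-energy
bounded) regime, where the conclusion is already a theorem (barrier
`AxisymmetricTypeIExclusion`); typed here as the missing transfer statement. -/
def BlowupLimitNonconstant : Prop :=
  ∀ ν : ℝ, 0 < ν → ∀ T : ℝ, 0 < T → ∀ (u₀ : ℝ³ → ℝ³) (g : HomSobolev ℝ³ ℂ³ (1 / 2 : ℝ))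
    (u : ℝ → ℝ³ → ℝ³), KatoAxisymFrame ν T u₀ g u →
    ∀ x₀ : ℝ³, cylRadius x₀ = 0 → ¬ IsBoundedNearTop u T x₀ →
      ∃ U : ℝ → ℝ³ → ℝ³, IsBoundedAncientMildSolution 1 U ∧
        (∀ t < 0, AEStronglyMeasurable (U t) volume) ∧ (∀ t < 0, IsAxisymmetric (U t)) ∧
        (∃ C : ℝ, ∀ t < 0, ∀ x, |swirl (U t) x| ≤ C) ∧
        ¬ ∀ t < 0, ∃ b : ℝ³, U t =ᵐ[volume] fun _ => b

/-- S-glue (pure logic): S⁺ and the (open, Type-II-strength) transfer give the lines' target. -/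
theorem axisPointsBounded_of_liouville (hL : StrengthenLiouville) (hB : BlowupLimitNonconstant) :
    AxisPointsBounded := by
  intro ν hν T hT u₀ g u hfr x₀ hx₀
  by_contra hnb
  obtain ⟨U, hanc, hmeas, hax, hsw, hnc⟩ := hB ν hν T hT u₀ g u hfr x₀ hx₀ hnb
  exact hnc (hL U hanc hmeas hax hsw)

/-! ## §N  Negation: the counterexample is an axisymmetric finite-time singularity -/

/-- `¬ crux` unfolded: an axisymmetric, weakly divergence-free `L³` datum represented in `Ḣ^{1/2}`
without a global Kato solution — i.e. axisymmetric blow-up in the critical class (Clay (C)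
strength up to the data class; Hou arXiv:2107.06509 is the only (numerical) candidate). -/
theorem not_crux_iff :
    ¬ AxisymmetricKatoGlobal ↔
      ∃ ν : ℝ, 0 < ν ∧ ∃ (u₀ : ℝ³ → ℝ³) (g : HomSobolev ℝ³ ℂ³ (1 / 2 : ℝ)),
        MemLp u₀ 3 volume ∧ g.Represents (Literature.Analysis.FunctionSpaces.EuclideanSpace.complexify ∘ u₀) ∧
        IsWeaklyDivFree u₀ ∧ IsAxisymmetric u₀ ∧ ¬ HasGlobalKatoSolution ν u₀ := by
  constructor
  · intro h
    by_contra hne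
    apply h
    intro ν hν u₀ g hL3 hrep hdiv hax
    by_contra hng
    exact hne ⟨ν, hν, u₀, g, hL3, hrep, hdiv, fun θ x => hax θ x, hng⟩
  · rintro ⟨ν, hν, u₀, g, hL3, hrep, hdiv, hax, hng⟩ h
    exact hng (h ν hν u₀ g hL3 hrep hdiv (fun θ x => hax θ x))

end Summit.NavierStokesRegularity.NavierStokesRegularity.Cruxes.AxisymmetricKatoGlobal.StrategistS12g4
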